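import Literature.NumberTheory.Transcendental.QuadraticRelationsLogarithmsSec6Lattice
import HarnessLib

/-!
# Roy–Waldschmidt 1997, §6 (i): the category `𝒞` — objects, morphisms, kernels and cokernels

D. Roy, M. Waldschmidt, *Approximation diophantienne et indépendance algébrique de logarithmes*,
Ann. Sci. ÉNS (4) 30 (1997) 753–796, §6 (i), pp. 785–786.  For a subfield `K ⊂ ℂ`, an object
of `𝒞` is a family (6.1) `X = (d₀, d₁, W, Y, Y_a)` with `d₀, d₁ ≥ 0`, `W` a `K`-subspace of
`K^{d₀} × K^{d₁}`, `Y` a finitely generated subgroup of `ℂ^{d₀} × ℂ^{d₁}` contained in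
`K^{d₀} × (𝓛_K)^{d₁}` and `Y_a` a subgroup of `Y` contained in `K^{d₀} × 𝓛^{d₁}`
(`𝓛_K = exp⁻¹(K^×)`, `𝓛 = exp⁻¹(ℚ̄^×)`); a morphism `X → X'` is a linear map
`g : ℂ^{d₀} × ℂ^{d₁} → ℂ^{d₀'} × ℂ^{d₁'}` with `g(K^{d₀} × 0) ⊆ K^{d₀'} × 0`,
`g(0 × ℚ^{d₁}) ⊆ 0 × ℚ^{d₁'}`, `g(W) ⊆ W'`, `g(Y) ⊆ Y'`, `g(Y_a) ⊆ Y_a'`.  The kernels of `𝒞` are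
the morphisms `m(f, X*, X)` with `f` injective and `W* = f⁻¹(W)`, `Y* = f⁻¹(Y)`, `Y_a* = f⁻¹(Y_a)`
(6.2); the cokernels are the `m(g, X, X')` with `g` surjective and `g(W) = W'`, `g(Y) = Y'`,
`g(Y_a) = Y_a'` (6.3) (p. 786: "on peut montrer").

This file DEFINES these notions (`RWObj`, `IsStruct`, `IsHom`, `IsCoker`, `IsKer`, and the
object-level relations `Quot`, `SubO`, `Exact` fed to the relational form of Proposition 6.1 in
`…Prop61.lean`) and PROVES the admissibility facts used in §6: morphisms are block-diagonal
`g = g₀ × g₁` with `g₀` defined over `K` and `g₁` over `ℚ` (`IsStruct.exists_block`), identities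
are kernels and cokernels, composites of cokernels (kernels) are cokernels (kernels), and — the
two constructions behind "on peut montrer" — every cokernel `X → X'` has a kernel object
`X* → X` and every kernel `X* → X` has a cokernel object `X → X'` (`IsCoker.exists_exact`,
`IsKer.exists_exact`), built with a `K`-basis of the `K`-points on the `𝐆_a`-part and with the
integral frames of `…Sec6Lattice.lean` on the `𝐆_m`-part (integrality is what keeps
`f⁻¹(Y) ⊆ K^{d₀*} × 𝓛_K^{d₁*}` and `g(Y) ⊆ K^{d₀'} × 𝓛_K^{d₁'}`).  No named facts.

## References

* [RoyWaldschmidt1997ENS] D. Roy, M. Waldschmidt, Ann. Sci. ÉNS (4) 30 (1997) 753–796, §6 (i),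
  (6.1)–(6.3), pp. 785–786 (read on the rendered scan).
-/

noncomputable section

open Complex IntermediateField Module Submodule

namespace Literature.NumberTheory.Transcendental

namespace RoyWaldschmidt1997

open LiePresentation

/-! ### Objects and morphisms of `𝒞` -/

/-- An **object of the category `𝒞`** of Roy–Waldschmidt §6 (6.1): `X = (d₀, d₁, W, Y, Y_a)` with
`W` a `K`-subspace of `K^{d₀} × K^{d₁}` (a `K`-submodule of `ℂ^{d₀} × ℂ^{d₁}` with coordinates
in `K`), `Y` a finitely generated subgroup of `ℂ^{d₀} × ℂ^{d₁}` contained in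
`K^{d₀} × (𝓛_K)^{d₁}` (`cexp` of the last `d₁` coordinates lies in `K`), and `Y_a ≤ Y` contained in
`K^{d₀} × 𝓛^{d₁}` (`cexp` of the last coordinates algebraic).
[cite: RoyWaldschmidt1997ENS, §6 (i), (6.1), p. 785] -/
structure RWObj (K : IntermediateField ℚ ℂ) where
  /-- dimension of the `𝐆_a`-part -/
  d₀ : ℕ
  /-- dimension of the `𝐆_m`-part -/
  d₁ : ℕ
  /-- the `K`-subspace `W ⊆ K^{d₀} × K^{d₁}` -/
  W : Submodule K ((Fin d₀ → ℂ) × (Fin d₁ → ℂ))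
  hW : ∀ w ∈ W, (∀ i, w.1 i ∈ K) ∧ (∀ j, w.2 j ∈ K)
  /-- the finitely generated subgroup `Y ⊆ K^{d₀} × (𝓛_K)^{d₁}` -/
  Y : Submodule ℤ ((Fin d₀ → ℂ) × (Fin d₁ → ℂ))
  hYfg : Y.FG
  hY : ∀ y ∈ Y, (∀ i, y.1 i ∈ K) ∧ (∀ j, cexp (y.2 j) ∈ K)
  /-- the subgroup `Y_a ≤ Y`, `Y_a ⊆ K^{d₀} × 𝓛^{d₁}` -/
  Ya : Submodule ℤ ((Fin d₀ → ℂ) × (Fin d₁ → ℂ))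
  hYa : Ya ≤ Y
  hYaL : ∀ y ∈ Ya, ∀ j, IsAlgebraic ℚ (cexp (y.2 j))

variable {K : IntermediateField ℚ ℂ}

/-- The structure conditions on the linear map underlying a morphism of `𝒞` (p. 786):
`g(K^{d₀} × 0) ⊆ K^{d₀'} × 0` and `g(0 × ℚ^{d₁}) ⊆ 0 × ℚ^{d₁'}`.
[cite: RoyWaldschmidt1997ENS, §6 (i), p. 786] -/
def IsStruct (K : IntermediateField ℚ ℂ) {d₀ d₁ d₀' d₁' : ℕ}
    (g : ((Fin d₀ → ℂ) × (Fin d₁ → ℂ)) →ₗ[ℂ] ((Fin d₀' → ℂ) × (Fin d₁' → ℂ))) : Prop :=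
  (∀ c : Fin d₀ → K, ∃ c' : Fin d₀' → K, g (ofK K c, 0) = (ofK K c', 0)) ∧
  (∀ q : Fin d₁ → ℚ, ∃ q' : Fin d₁' → ℚ,
    g (0, fun j => ((q j : ℚ) : ℂ)) = (0, fun j => ((q' j : ℚ) : ℂ)))

/-- **Morphisms of `𝒞`** `m(g, X, X')` (p. 786): structure conditions and `g(W) ⊆ W'`,
`g(Y) ⊆ Y'`, `g(Y_a) ⊆ Y_a'`. [cite: RoyWaldschmidt1997ENS, §6 (i), p. 786] -/
def IsHom (X X' : RWObj K)
    (g : ((Fin X.d₀ → ℂ) × (Fin X.d₁ → ℂ)) →ₗ[ℂ] ((Fin X'.d₀ → ℂ) × (Fin X'.d₁ → ℂ))) : Prop :=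
  IsStruct K g ∧ X.W.map (g.restrictScalars K) ≤ X'.W ∧ X.Y.map (g.restrictScalars ℤ) ≤ X'.Y ∧
    X.Ya.map (g.restrictScalars ℤ) ≤ X'.Ya

/-- **Cokernels of `𝒞`** (6.3): morphisms with `g` surjective, `g(W) = W'`, `g(Y) = Y'`,
`g(Y_a) = Y_a'`. [cite: RoyWaldschmidt1997ENS, §6 (i), (6.3), p. 786] -/
def IsCoker (X X' : RWObj K)
    (g : ((Fin X.d₀ → ℂ) × (Fin X.d₁ → ℂ)) →ₗ[ℂ] ((Fin X'.d₀ → ℂ) × (Fin X'.d₁ → ℂ))) : Prop :=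
  IsHom X X' g ∧ Function.Surjective g ∧ X.W.map (g.restrictScalars K) = X'.W ∧
    X.Y.map (g.restrictScalars ℤ) = X'.Y ∧ X.Ya.map (g.restrictScalars ℤ) = X'.Ya

/-- **Kernels of `𝒞`** (6.2): morphisms with `f` injective, `W* = f⁻¹(W)`, `Y* = f⁻¹(Y)`,
`Y_a* = f⁻¹(Y_a)`. [cite: RoyWaldschmidt1997ENS, §6 (i), (6.2), p. 786] -/
def IsKer (Xs X : RWObj K)
    (f : ((Fin Xs.d₀ → ℂ) × (Fin Xs.d₁ → ℂ)) →ₗ[ℂ] ((Fin X.d₀ → ℂ) × (Fin X.d₁ → ℂ))) : Prop :=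
  IsHom Xs X f ∧ Function.Injective f ∧ Xs.W = X.W.comap (f.restrictScalars K) ∧
    Xs.Y = X.Y.comap (f.restrictScalars ℤ) ∧ Xs.Ya = X.Ya.comap (f.restrictScalars ℤ)

/-- `X'` is a quotient of `X` by a cokernel of `𝒞`. [cite: RoyWaldschmidt1997ENS, §6 (i), p. 786] -/
def Quot (X X' : RWObj K) : Prop :=
  ∃ g, IsCoker X X' g

/-- `Xs` is a subobject of `X` by a kernel of `𝒞`. [cite: RoyWaldschmidt1997ENS, §6 (i), p. 786] -/
def SubO (Xs X : RWObj K) : Prop :=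
  ∃ f, IsKer Xs X f

/-- An exact triple `Xs → X → X'` of `𝒞`: a kernel `f`, a cokernel `g` with `im f = ker g` (the
pairs "`i` noyau de `s`, `s` conoyau de `i`" of Proposition 6.1, p. 785).
[cite: RoyWaldschmidt1997ENS, §6, pp. 784–786] -/
def Exact (Xs X X' : RWObj K) : Prop :=
  ∃ f g, IsKer Xs X f ∧ IsCoker X X' g ∧ LinearMap.range f = LinearMap.ker g

/-- An exact triple gives a quotient. [folklore] -/
theorem Exact.quot {Xs X X' : RWObj K} (h : Exact Xs X X') : Quot X X' := by
  obtain ⟨f, g, -, hg, -⟩ := h; exact ⟨g, hg⟩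

/-- An exact triple gives a subobject. [folklore] -/
theorem Exact.subO {Xs X X' : RWObj K} (h : Exact Xs X X') : SubO Xs X := by
  obtain ⟨f, g, hf, -, -⟩ := h; exact ⟨f, hf⟩

/-! ### Structure maps are block-diagonal -/

/-- **Block decomposition.**  A linear map with `g(K^{d₀} × 0) ⊆ K^{d₀'} × 0` and
`g(0 × ℚ^{d₁}) ⊆ 0 × ℚ^{d₁'}` is `g = g₀ × g₁` with `g₀` defined over `K` and `g₁` defined over
`ℚ` (p. 759: "`g` est le produit d'une application linéaire `g₀` définie sur `K` et d'une
application linéaire `g₁` définie sur `ℚ`"). [cite: RoyWaldschmidt1997ENS, p. 759 and §6 (i)] -/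
theorem IsStruct.exists_block {d₀ d₁ d₀' d₁' : ℕ}
    {g : ((Fin d₀ → ℂ) × (Fin d₁ → ℂ)) →ₗ[ℂ] ((Fin d₀' → ℂ) × (Fin d₁' → ℂ))} (hg : IsStruct K g) :
    ∃ (g₀ : (Fin d₀ → ℂ) →ₗ[ℂ] (Fin d₀' → ℂ)) (g₁ : (Fin d₁ → ℂ) →ₗ[ℂ] (Fin d₁' → ℂ))
      (g₀K : (Fin d₀ → K) →ₗ[K] (Fin d₀' → K)) (g₁₀ : (Fin d₁ → ℚ) →ₗ[ℚ] (Fin d₁' → ℚ)),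
      (∀ p, g p = (g₀ p.1, g₁ p.2)) ∧ (∀ c, g₀ (ofK K c) = ofK K (g₀K c)) ∧
      (∀ q : Fin d₁ → ℚ, g₁ (fun j => ((q j : ℚ) : ℂ)) = fun i => ((g₁₀ q i : ℚ) : ℂ)) := by
  obtain ⟨hK, hQ⟩ := hg
  -- the off-diagonal blocks vanish
  have hg2 : ∀ u : Fin d₀ → ℂ, (g (u, 0)).2 = 0 := by
    intro u
    have htop := eq_top_of_forall_ofK_mem K
      (T := LinearMap.ker ((LinearMap.snd ℂ _ _).comp (g.comp (LinearMap.inl ℂ _ _)))) fun c => by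
        obtain ⟨c', hc'⟩ := hK c
        show (g (ofK K c, 0)).2 = 0
        rw [hc']
    have : u ∈ LinearMap.ker ((LinearMap.snd ℂ _ _).comp (g.comp (LinearMap.inl ℂ _ _))) := by
      rw [htop]; trivial
    exact this
  have hg1 : ∀ v : Fin d₁ → ℂ, (g (0, v)).1 = 0 := by
    intro v
    have htop := eq_top_of_forall_rat_mem
      (T := LinearMap.ker ((LinearMap.fst ℂ _ _).comp (g.comp (LinearMap.inr ℂ _ _)))) fun q => by
        obtain ⟨q', hq'⟩ := hQ q
        show (g (0, fun j => ((q j : ℚ) : ℂ))).1 = 0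
        rw [hq']
    have : v ∈ LinearMap.ker ((LinearMap.fst ℂ _ _).comp (g.comp (LinearMap.inr ℂ _ _))) := by
      rw [htop]; trivial
    exact this
  set g₀ : (Fin d₀ → ℂ) →ₗ[ℂ] (Fin d₀' → ℂ) := (LinearMap.fst ℂ _ _).comp (g.comp (LinearMap.inl ℂ _ _))
  set g₁ : (Fin d₁ → ℂ) →ₗ[ℂ] (Fin d₁' → ℂ) := (LinearMap.snd ℂ _ _).comp (g.comp (LinearMap.inr ℂ _ _))
  have hg_apply : ∀ p, g p = (g₀ p.1, g₁ p.2) := by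
    rintro ⟨u, v⟩
    have : g (u, v) = g (u, 0) + g (0, v) := by rw [← map_add]; simp
    rw [this]
    ext1
    · simp only [Prod.fst_add, hg1 v, add_zero]; rfl
    · simp only [Prod.snd_add, hg2 u, zero_add]; rfl
  have hg₀K : ∀ c : Fin d₀ → K, ∃ c' : Fin d₀' → K, g₀ (ofK K c) = ofK K c' := by
    intro c
    obtain ⟨c', hc'⟩ := hK c
    refine ⟨c', ?_⟩
    have := congrArg Prod.fst hc'
    rw [hg_apply] at this
    exact this
  have hg₁Q : ∀ q : Fin d₁ → ℚ, ∃ q' : Fin d₁' → ℚ, g₁ (fun j => ((q j : ℚ) : ℂ)) = fun i => ((q' i : ℚ) : ℂ) := by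
    intro q
    obtain ⟨q', hq'⟩ := hQ q
    refine ⟨q', ?_⟩
    have := congrArg Prod.snd hq'
    rw [hg_apply] at this
    exact this
  obtain ⟨g₀K, hg₀K'⟩ := exists_kStructure K g₀ hg₀K
  obtain ⟨g₁₀, hg₁₀⟩ := exists_ratStructure g₁ hg₁Q
  exact ⟨g₀, g₁, g₀K, g₁₀, hg_apply, hg₀K', hg₁₀⟩

/-- Conversely, a block map `g₀ × g₁` with `g₀` defined over `K` and `g₁` over `ℚ` satisfies the
structure conditions. [folklore] -/
theorem isStruct_of_block {d₀ d₁ d₀' d₁' : ℕ}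
    (g : ((Fin d₀ → ℂ) × (Fin d₁ → ℂ)) →ₗ[ℂ] ((Fin d₀' → ℂ) × (Fin d₁' → ℂ)))
    (g₀ : (Fin d₀ → ℂ) →ₗ[ℂ] (Fin d₀' → ℂ)) (g₁ : (Fin d₁ → ℂ) →ₗ[ℂ] (Fin d₁' → ℂ))
    (hg : ∀ p, g p = (g₀ p.1, g₁ p.2)) (hg₀ : ∀ c : Fin d₀ → K, ∃ c' : Fin d₀' → K, g₀ (ofK K c) = ofK K c')
    (hg₁ : ∀ q : Fin d₁ → ℚ, ∃ q' : Fin d₁' → ℚ, g₁ (fun j => ((q j : ℚ) : ℂ)) = fun i => ((q' i : ℚ) : ℂ)) :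
    IsStruct K g := by
  refine ⟨fun c => ?_, fun q => ?_⟩
  · obtain ⟨c', hc'⟩ := hg₀ c
    exact ⟨c', by rw [hg]; simp [hc']⟩
  · obtain ⟨q', hq'⟩ := hg₁ q
    exact ⟨q', by rw [hg]; simp [hq']⟩

/-! ### Identities and composites -/

/-- The identity is a cokernel and a kernel of `𝒞`. [folklore] -/
theorem isCoker_id (X : RWObj K) : IsCoker X X LinearMap.id := by
  have h1 : (LinearMap.id : ((Fin X.d₀ → ℂ) × (Fin X.d₁ → ℂ)) →ₗ[ℂ] _).restrictScalars K = LinearMap.id := rfl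
  have h2 : (LinearMap.id : ((Fin X.d₀ → ℂ) × (Fin X.d₁ → ℂ)) →ₗ[ℂ] _).restrictScalars ℤ = LinearMap.id := rfl
  refine ⟨⟨⟨fun c => ⟨c, rfl⟩, fun q => ⟨q, rfl⟩⟩, ?_, ?_, ?_⟩, Function.surjective_id, ?_, ?_, ?_⟩ <;>
    simp [h1, h2, Submodule.map_id]

/-- The identity is a kernel of `𝒞`. [folklore] -/
theorem isKer_id (X : RWObj K) : IsKer X X LinearMap.id := by
  have h1 : (LinearMap.id : ((Fin X.d₀ → ℂ) × (Fin X.d₁ → ℂ)) →ₗ[ℂ] _).restrictScalars K = LinearMap.id := rfl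
  have h2 : (LinearMap.id : ((Fin X.d₀ → ℂ) × (Fin X.d₁ → ℂ)) →ₗ[ℂ] _).restrictScalars ℤ = LinearMap.id := rfl
  refine ⟨⟨⟨fun c => ⟨c, rfl⟩, fun q => ⟨q, rfl⟩⟩, ?_, ?_, ?_⟩, Function.injective_id, ?_, ?_, ?_⟩ <;>
    simp [h1, h2, Submodule.map_id, Submodule.comap_id]

/-- `Quot` is reflexive. [folklore] -/
theorem quot_refl (X : RWObj K) : Quot X X := ⟨_, isCoker_id X⟩

/-- `SubO` is reflexive. [folklore] -/
theorem subO_refl (X : RWObj K) : SubO X X := ⟨_, isKer_id X⟩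

/-- Structure conditions are stable under composition. [folklore] -/
theorem IsStruct.comp {d₀ d₁ d₀' d₁' d₀'' d₁'' : ℕ}
    {g : ((Fin d₀ → ℂ) × (Fin d₁ → ℂ)) →ₗ[ℂ] ((Fin d₀' → ℂ) × (Fin d₁' → ℂ))}
    {g' : ((Fin d₀' → ℂ) × (Fin d₁' → ℂ)) →ₗ[ℂ] ((Fin d₀'' → ℂ) × (Fin d₁'' → ℂ))}
    (hg : IsStruct K g) (hg' : IsStruct K g') : IsStruct K (g'.comp g) := by
  refine ⟨fun c => ?_, fun q => ?_⟩
  · obtain ⟨c', hc'⟩ := hg.1 c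
    obtain ⟨c'', hc''⟩ := hg'.1 c'
    exact ⟨c'', by rw [LinearMap.comp_apply, hc', hc'']⟩
  · obtain ⟨q', hq'⟩ := hg.2 q
    obtain ⟨q'', hq''⟩ := hg'.2 q'
    exact ⟨q'', by rw [LinearMap.comp_apply, hq', hq'']⟩

/-- **Composites of cokernels are cokernels.** [cite: RoyWaldschmidt1997ENS, §6 (i), p. 786] -/
theorem IsCoker.comp {X X' X'' : RWObj K} {g g'} (hg : IsCoker X X' g) (hg' : IsCoker X' X'' g') :
    IsCoker X X'' (g'.comp g) := by
  obtain ⟨⟨hs, -, -, -⟩, hsurj, hW, hY, hYa⟩ := hg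
  obtain ⟨⟨hs', -, -, -⟩, hsurj', hW', hY', hYa'⟩ := hg'
  have eW : X.W.map ((g'.comp g).restrictScalars K) = X''.W := by
    rw [LinearMap.restrictScalars_comp]  -- may be stated differently
    rw [Submodule.map_comp, hW, hW']
  have eY : X.Y.map ((g'.comp g).restrictScalars ℤ) = X''.Y := by
    rw [LinearMap.restrictScalars_comp, Submodule.map_comp, hY, hY']
  have eYa : X.Ya.map ((g'.comp g).restrictScalars ℤ) = X''.Ya := by
    rw [LinearMap.restrictScalars_comp, Submodule.map_comp, hYa, hYa']
  exact ⟨⟨hs.comp hs', eW.le, eY.le, eYa.le⟩, hsurj'.comp hsurj, eW, eY, eYa⟩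

/-- **Composites of kernels are kernels.** [cite: RoyWaldschmidt1997ENS, §6 (i), p. 786] -/
theorem IsKer.comp {Xss Xs X : RWObj K} {f f'} (hf : IsKer Xss Xs f) (hf' : IsKer Xs X f') :
    IsKer Xss X (f'.comp f) := by
  obtain ⟨⟨hs, -, -, -⟩, hinj, hW, hY, hYa⟩ := hf
  obtain ⟨⟨hs', -, -, -⟩, hinj', hW', hY', hYa'⟩ := hf'
  have eW : Xss.W = X.W.comap ((f'.comp f).restrictScalars K) := by
    rw [LinearMap.restrictScalars_comp, Submodule.comap_comp, ← hW', ← hW]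
  have eY : Xss.Y = X.Y.comap ((f'.comp f).restrictScalars ℤ) := by
    rw [LinearMap.restrictScalars_comp, Submodule.comap_comp, ← hY', ← hY]
  have eYa : Xss.Ya = X.Ya.comap ((f'.comp f).restrictScalars ℤ) := by
    rw [LinearMap.restrictScalars_comp, Submodule.comap_comp, ← hYa', ← hYa]
  refine ⟨⟨hs.comp hs', ?_, ?_, ?_⟩, hinj'.comp hinj, eW, eY, eYa⟩
  · rw [eW]; exact Submodule.map_comap_le _ _
  · rw [eY]; exact Submodule.map_comap_le _ _
  · rw [eYa]; exact Submodule.map_comap_le _ _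

/-- `Quot` is transitive (composites of cokernels). [cite: RoyWaldschmidt1997ENS, §6 (i), p. 786] -/
theorem quot_trans {X X' X'' : RWObj K} (h : Quot X X') (h' : Quot X' X'') : Quot X X'' := by
  obtain ⟨g, hg⟩ := h; obtain ⟨g', hg'⟩ := h'; exact ⟨_, hg.comp hg'⟩

/-- `SubO` is transitive (composites of kernels). [cite: RoyWaldschmidt1997ENS, §6 (i), p. 786] -/
theorem subO_trans {Xss Xs X : RWObj K} (h : SubO Xss Xs) (h' : SubO Xs X) : SubO Xss X := by
  obtain ⟨f, hf⟩ := h; obtain ⟨f', hf'⟩ := h'; exact ⟨_, hf.comp hf'⟩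

/-! ### Frames of subspaces defined over `K` -/

/-- `ℂ`-span of `ofK` of a `K`-span is the `ℂ`-span of `ofK` of the generators. [folklore] -/
theorem span_ofK_span (K : IntermediateField ℚ ℂ) {σ : Type*} (S : Set (σ → K)) :
    span ℂ (ofK K (L := ℂ) '' (span K S : Set (σ → K))) = span ℂ (ofK K (L := ℂ) '' S) := by
  refine le_antisymm (span_le.mpr ?_) (span_mono (Set.image_mono subset_span))
  rintro _ ⟨v, hv, rfl⟩
  induction hv using Submodule.span_induction with
  | mem x hx => exact subset_span ⟨x, hx, rfl⟩
  | zero =>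
    have : ofK K (L := ℂ) (0 : σ → K) = 0 := by funext i; simp [ofK_apply]
    rw [this]; exact Submodule.zero_mem _
  | add x y _ _ hx hy =>
    have : ofK K (L := ℂ) (x + y) = ofK K x + ofK K y := by funext i; simp
    rw [this]; exact Submodule.add_mem _ hx hy
  | smul c x _ hx =>
    have : ofK K (L := ℂ) (c • x) = (c : ℂ) • ofK K x := by funext i; simp [Algebra.smul_def]
    rw [this]; exact Submodule.smul_mem _ _ hx

/-- **`K`-frame.**  A subspace `R ⊆ ℂⁿ` defined over `K` is the isomorphic image of some `ℂ^e` under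
an injective linear map defined over `K` whose `K`-points descend. [folklore] -/
theorem exists_kFrame (K : IntermediateField ℚ ℂ) {n : ℕ} (R : Submodule ℂ (Fin n → ℂ))
    (hR : IsKRational K R) :
    ∃ (e : ℕ) (f₀ : (Fin e → ℂ) →ₗ[ℂ] (Fin n → ℂ)) (f₀K : (Fin e → K) →ₗ[K] (Fin n → K)),
      Function.Injective f₀ ∧ LinearMap.range f₀ = R ∧ (∀ c, f₀ (ofK K c) = ofK K (f₀K c)) ∧
      (∀ u, (∀ i, f₀ u i ∈ K) → ∃ c, u = ofK K c) ∧ Module.finrank ℂ R = e := by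
  classical
  set P : Submodule K (Fin n → K) := kPoints K R with hP
  set e := Module.finrank K P with he
  let bP : Basis (Fin e) K P := Module.finBasis K P
  let v : Fin e → Fin n → K := fun i => (bP i : Fin n → K)
  have hvspan : span K (Set.range v) = P := by
    have h1 := bP.span_eq
    have h2 : Set.range v = P.subtype '' Set.range bP := by
      ext x; constructor
      · rintro ⟨i, rfl⟩; exact ⟨bP i, ⟨i, rfl⟩, rfl⟩
      · rintro ⟨_, ⟨i, rfl⟩, rfl⟩; exact ⟨i, rfl⟩
    rw [h2, ← Submodule.map_span, h1, Submodule.map_top, Submodule.range_subtype]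
  set f₀ : (Fin e → ℂ) →ₗ[ℂ] (Fin n → ℂ) := Fintype.linearCombination ℂ (fun i => ofK K (L := ℂ) (v i))
    with hf₀
  set f₀K : (Fin e → K) →ₗ[K] (Fin n → K) := Fintype.linearCombination K v with hf₀K
  have hf₀_ofK : ∀ c, f₀ (ofK K c) = ofK K (f₀K c) := by
    intro c
    rw [hf₀, hf₀K, Fintype.linearCombination_apply, Fintype.linearCombination_apply]
    funext j
    simp only [Finset.sum_apply, Pi.smul_apply, smul_eq_mul, ofK_apply, map_sum, map_mul]
  have hrange_eq : LinearMap.range f₀ = span ℂ (ofK K (L := ℂ) '' Set.range v) := by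
    rw [hf₀, Fintype.range_linearCombination, ← Set.range_comp]; rfl
  have hrange : LinearMap.range f₀ = R := by
    rw [hrange_eq, ← span_ofK_span, hvspan, hP, ← hR.eq_span_kPoints]
  have hfr : Module.finrank ℂ R = e := by rw [he, hP]; exact hR.finrank_eq
  have hinj : Function.Injective f₀ := by
    rw [hf₀]
    refine LinearIndependent.fintypeLinearCombination_injective ?_
    rw [linearIndependent_iff_card_eq_finrank_span, Fintype.card_fin]
    show e = Module.finrank ℂ (span ℂ (Set.range (ofK K (L := ℂ) ∘ v)))
    rw [Set.range_comp, ← hrange_eq, hrange, hfr]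
  refine ⟨e, f₀, f₀K, hinj, hrange, hf₀_ofK, fun u hu => ?_, hfr⟩
  -- descent of `K`-points
  set uK : Fin n → K := fun i => ⟨f₀ u i, hu i⟩
  have huK : ofK K (L := ℂ) uK = f₀ u := funext fun i => rfl
  have h1 : uK ∈ kPoints K (span ℂ (ofK K (L := ℂ) '' Set.range v)) := by
    rw [mem_kPoints, huK, ← hrange_eq]; exact ⟨u, rfl⟩
  rw [kPoints_span_ofK] at h1
  obtain ⟨c, hc⟩ := (Submodule.mem_span_range_iff_exists_fun K).mp h1
  refine ⟨c, hinj ?_⟩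
  rw [hf₀_ofK, ← huK, ← hc, hf₀K, Fintype.linearCombination_apply]

/-- **`K`-quotient.**  For `R ⊆ ℂⁿ` defined over `K` there is a surjective linear map `ℂⁿ → ℂ^e`
defined over `K` with kernel `R`. [folklore] -/
theorem exists_kQuot (K : IntermediateField ℚ ℂ) {n : ℕ} (R : Submodule ℂ (Fin n → ℂ))
    (hR : IsKRational K R) :
    ∃ (e : ℕ) (g₀ : (Fin n → ℂ) →ₗ[ℂ] (Fin e → ℂ)) (g₀K : (Fin n → K) →ₗ[K] (Fin e → K)),
      Function.Surjective g₀ ∧ LinearMap.ker g₀ = R ∧ (∀ c, g₀ (ofK K c) = ofK K (g₀K c)) ∧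
      Module.finrank ℂ R + e = n := by
  classical
  set P : Submodule K (Fin n → K) := kPoints K R with hP
  set e := Module.finrank K ((Fin n → K) ⧸ P) with he
  let bQ : Basis (Fin e) K ((Fin n → K) ⧸ P) := Module.finBasis K _
  set g₀K : (Fin n → K) →ₗ[K] (Fin e → K) := bQ.equivFun.toLinearMap.comp P.mkQ with hg₀K
  have hg₀Ksurj : Function.Surjective g₀K := by
    rw [hg₀K, LinearMap.coe_comp]
    exact bQ.equivFun.surjective.comp (Submodule.mkQ_surjective P)
  have hg₀Kker : LinearMap.ker g₀K = P := by
    rw [hg₀K, LinearMap.ker_comp, LinearEquiv.ker, Submodule.comap_bot, Submodule.ker_mkQ]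
  -- complexification
  set g₀ : (Fin n → ℂ) →ₗ[ℂ] (Fin e → ℂ) :=
    Fintype.linearCombination ℂ (fun j => ofK K (L := ℂ) (g₀K (Pi.single j 1))) with hg₀
  have hg₀_ofK : ∀ c, g₀ (ofK K c) = ofK K (g₀K c) := by
    intro c
    have hc : c = ∑ j, c j • (Pi.single j (1 : K) : Fin n → K) := by
      funext i; simp [Finset.sum_apply, Pi.single_apply]
    have h1 : g₀K c = ∑ j, c j • g₀K (Pi.single j 1) := by
      conv_lhs => rw [hc]
      rw [map_sum]
      exact Finset.sum_congr rfl fun j _ => by rw [map_smul]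
    rw [h1, ofK_sum_smul, hg₀, Fintype.linearCombination_apply]
    exact Finset.sum_congr rfl fun j _ => rfl
  have hsurj : Function.Surjective g₀ := by
    rw [← LinearMap.range_eq_top]
    refine eq_top_of_forall_ofK_mem K fun c' => ?_
    obtain ⟨c, rfl⟩ := hg₀Ksurj c'
    exact ⟨ofK K c, hg₀_ofK c⟩
  have hPR : Module.finrank K P = Module.finrank ℂ R := by rw [hP]; exact hR.finrank_eq.symm
  have hdim : Module.finrank ℂ R + e = n := by
    rw [← hPR, he, add_comm, Submodule.finrank_quotient_add_finrank, Module.finrank_fin_fun]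
  have hRle : R ≤ LinearMap.ker g₀ := by
    rw [hR.eq_span_kPoints]
    refine span_le.mpr ?_
    rintro _ ⟨p, hp, rfl⟩
    rw [SetLike.mem_coe, LinearMap.mem_ker, hg₀_ofK]
    have : g₀K p = 0 := by rw [← LinearMap.mem_ker, hg₀Kker]; exact hp
    rw [this]; funext i; simp [ofK_apply]
  have hker : LinearMap.ker g₀ = R := by
    refine (Submodule.eq_of_le_of_finrank_eq hRle ?_).symm
    have h1 := LinearMap.finrank_range_add_finrank_ker g₀
    rw [LinearMap.range_eq_top.mpr hsurj, finrank_top, Module.finrank_fin_fun, Module.finrank_fin_fun] at h1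
    omega
  exact ⟨e, g₀, g₀K, hsurj, hker, hg₀_ofK, hdim⟩

/-! ### Integral frames on the `𝐆_m`-part -/

/-- `mulVecLin` of the cast of an integer matrix, in coordinates. [folklore] -/
theorem mulVecLin_intCast_apply {a b : ℕ} (M : Matrix (Fin a) (Fin b) ℤ) (v : Fin b → ℂ) (i : Fin a) :
    (M.map (Int.castRingHom ℂ)).mulVecLin v i = ∑ j, (M i j : ℂ) * v j := by
  simp [Matrix.mulVec, dotProduct, Matrix.map_apply]

/-- Products of casts of integer matrices. [folklore] -/
theorem mulVecLin_intCast_comp {a b c : ℕ} (M : Matrix (Fin a) (Fin b) ℤ) (N : Matrix (Fin b) (Fin c) ℤ) :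
    (M.map (Int.castRingHom ℂ)).mulVecLin.comp (N.map (Int.castRingHom ℂ)).mulVecLin =
      ((M * N).map (Int.castRingHom ℂ)).mulVecLin := by
  rw [← Matrix.mulVecLin_mul, Matrix.map_mul]

/-- **Integral frame.**  A subspace `R ⊆ ℂⁿ` defined over `ℚ` is the isomorphic image of some `ℂ^k`
under the map of an integer matrix `A` admitting an integer left inverse `B`. [folklore] -/
theorem exists_intFrame {n : ℕ} (R : Submodule ℂ (Fin n → ℂ)) (hR : IsKRational ℚ R) :
    ∃ (k : ℕ) (f₁ : (Fin k → ℂ) →ₗ[ℂ] (Fin n → ℂ)) (A : Matrix (Fin n) (Fin k) ℤ) (B : Matrix (Fin k) (Fin n) ℤ),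
      Function.Injective f₁ ∧ LinearMap.range f₁ = R ∧ (∀ v i, f₁ v i = ∑ j, (A i j : ℂ) * v j) ∧
      (∀ v j, v j = ∑ i, (B j i : ℂ) * f₁ v i) ∧ Module.finrank ℂ R = k := by
  obtain ⟨k, A, B, C, D, -, hBA, -, -, -, -, hfr, hS⟩ := exists_integral_frame R hR
  set f₁ := (A.map (Int.castRingHom ℂ)).mulVecLin with hf₁
  have hleft : (B.map (Int.castRingHom ℂ)).mulVecLin.comp f₁ = LinearMap.id := by
    rw [hf₁, mulVecLin_intCast_comp, hBA]; simp
  have hinj : Function.Injective f₁ := by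
    intro v w h
    have := congrArg (B.map (Int.castRingHom ℂ)).mulVecLin h
    rwa [← LinearMap.comp_apply, ← LinearMap.comp_apply, hleft] at this
  have hcols : Set.range (A.map (Int.castRingHom ℂ)).col = Set.range fun j : Fin k => fun i => ((A i j : ℤ) : ℂ) := by
    ext w; simp only [Set.mem_range]
    constructor <;> rintro ⟨j, rfl⟩ <;> exact ⟨j, by funext i; simp [Matrix.map_apply]⟩
  have hrange : LinearMap.range f₁ = R := by
    rw [hf₁, Matrix.range_mulVecLin, hcols, hS]
  refine ⟨k, f₁, A, B, hinj, hrange, fun v i => ?_, fun v j => ?_, hfr⟩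
  · rw [hf₁, mulVecLin_intCast_apply]
  · have := LinearMap.congr_fun hleft v
    rw [LinearMap.comp_apply, LinearMap.id_apply] at this
    conv_lhs => rw [← this]
    rw [mulVecLin_intCast_apply]

/-- **Integral quotient.**  For `R ⊆ ℂⁿ` defined over `ℚ` of dimension `k` there is a surjective
linear map `ℂⁿ → ℂ^{n-k}` with kernel `R` given by an integer matrix. [folklore] -/
theorem exists_intQuot {n : ℕ} (R : Submodule ℂ (Fin n → ℂ)) (hR : IsKRational ℚ R) :
    ∃ (k : ℕ) (g₁ : (Fin n → ℂ) →ₗ[ℂ] (Fin (n - k) → ℂ)) (C : Matrix (Fin (n - k)) (Fin n) ℤ),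
      Function.Surjective g₁ ∧ LinearMap.ker g₁ = R ∧ (∀ v l, g₁ v l = ∑ j, (C l j : ℂ) * v j) ∧
      Module.finrank ℂ R = k ∧ k ≤ n := by
  obtain ⟨k, A, B, C, D, hkm, -, hCD, hCA, -, hsum, hfr, hS⟩ := exists_integral_frame R hR
  set g₁ := (C.map (Int.castRingHom ℂ)).mulVecLin with hg₁
  have hright : g₁.comp (D.map (Int.castRingHom ℂ)).mulVecLin = LinearMap.id := by
    rw [hg₁, mulVecLin_intCast_comp, hCD]; simp
  have hsurj : Function.Surjective g₁ := by
    intro w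
    refine ⟨(D.map (Int.castRingHom ℂ)).mulVecLin w, ?_⟩
    have := LinearMap.congr_fun hright w
    rwa [LinearMap.comp_apply] at this
  have hcols : Set.range (A.map (Int.castRingHom ℂ)).col = Set.range fun j : Fin k => fun i => ((A i j : ℤ) : ℂ) := by
    ext w; simp only [Set.mem_range]
    constructor <;> rintro ⟨j, rfl⟩ <;> exact ⟨j, by funext i; simp [Matrix.map_apply]⟩
  have hAf : LinearMap.range (A.map (Int.castRingHom ℂ)).mulVecLin = R := by
    rw [Matrix.range_mulVecLin, hcols, hS]
  have hker : LinearMap.ker g₁ = R := by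
    refine le_antisymm ?_ ?_
    · intro x hx
      rw [LinearMap.mem_ker] at hx
      -- `x = A (B x) + D (C x) = A (B x)`
      have hx' : x = (A.map (Int.castRingHom ℂ)).mulVecLin ((B.map (Int.castRingHom ℂ)).mulVecLin x) := by
        have h1 : ((A * B + D * C).map (Int.castRingHom ℂ)).mulVecLin x = x := by rw [hsum]; simp
        rw [Matrix.map_add (⇑(Int.castRingHom ℂ)) (fun a₁ a₂ => map_add _ a₁ a₂), Matrix.mulVecLin_add,
          LinearMap.add_apply, ← mulVecLin_intCast_comp, ← mulVecLin_intCast_comp, LinearMap.comp_apply,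
          LinearMap.comp_apply] at h1
        rw [← hg₁] at h1
        rw [hx, map_zero, add_zero] at h1
        exact h1.symm
      rw [← hAf, hx']
      exact ⟨_, rfl⟩
    · rw [← hAf]
      rintro _ ⟨v, rfl⟩
      rw [LinearMap.mem_ker, hg₁, ← LinearMap.comp_apply, mulVecLin_intCast_comp, hCA]
      simp
  refine ⟨k, g₁, C, hsurj, hker, fun v l => ?_, hfr, hkm⟩
  rw [hg₁, mulVecLin_intCast_apply]

/-! ### Kernels of cokernels, cokernels of kernels -/

/-- Rational vectors are mapped to rational vectors by an integer matrix. [folklore] -/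
theorem exists_rat_of_int_matrix {a b : ℕ} (M : Matrix (Fin a) (Fin b) ℤ) (h : (Fin b → ℂ) →ₗ[ℂ] (Fin a → ℂ))
    (hh : ∀ v i, h v i = ∑ j, (M i j : ℂ) * v j) (q : Fin b → ℚ) :
    ∃ q' : Fin a → ℚ, h (fun j => ((q j : ℚ) : ℂ)) = fun i => ((q' i : ℚ) : ℂ) :=
  ⟨fun i => ∑ j, (M i j : ℚ) * q j, by funext i; rw [hh]; push_cast; rfl⟩

/-- A vector with coordinates in `K` is `ofK` of a `K`-vector. [folklore] -/
theorem exists_ofK_of_mem (K : IntermediateField ℚ ℂ) {n : ℕ} {u : Fin n → ℂ} (hu : ∀ i, u i ∈ K) :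
    ∃ c : Fin n → K, u = ofK K c :=
  ⟨fun i => ⟨u i, hu i⟩, funext fun _ => rfl⟩

/-- The kernel of a map defined over `K` is defined over `K`. [folklore] -/
theorem isKRational_ker {a b : ℕ} (g₀ : (Fin a → ℂ) →ₗ[ℂ] (Fin b → ℂ)) (g₀K : (Fin a → K) →ₗ[K] (Fin b → K))
    (hg₀ : ∀ c, g₀ (ofK K c) = ofK K (g₀K c)) : IsKRational K (LinearMap.ker g₀) := by
  classical
  have hbot : IsKRational K (⊥ : Submodule ℂ (Fin b → ℂ)) := ⟨∅, by simp⟩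
  have := IsKRational.comap_of_ofK g₀ g₀K hg₀ hbot
  rwa [Submodule.comap_bot] at this

/-- The kernel of a map defined over `ℚ` is defined over `ℚ`. [folklore] -/
theorem isKRational_ker_rat {a b : ℕ} (g₁ : (Fin a → ℂ) →ₗ[ℂ] (Fin b → ℂ)) (g₁₀ : (Fin a → ℚ) →ₗ[ℚ] (Fin b → ℚ))
    (hg₁ : ∀ q : Fin a → ℚ, g₁ (fun j => ((q j : ℚ) : ℂ)) = fun i => ((g₁₀ q i : ℚ) : ℂ)) :
    IsKRational ℚ (LinearMap.ker g₁) := by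
  classical
  have hbot : IsKRational ℚ (⊥ : Submodule ℂ (Fin b → ℂ)) := ⟨∅, by simp⟩
  have := IsKRational.comap_of_ofK g₁ g₁₀ (fun q => by rw [ofK_rat_eq, ofK_rat_eq, hg₁]) hbot
  rwa [Submodule.comap_bot] at this

/-- The image of a map defined over `K` is the `ℂ`-span of the `ofK` of the image of its
`K`-form. [folklore] -/
theorem range_eq_span_of_ofK {a b : ℕ} (f₀ : (Fin a → ℂ) →ₗ[ℂ] (Fin b → ℂ)) (f₀K : (Fin a → K) →ₗ[K] (Fin b → K))
    (hf₀ : ∀ c, f₀ (ofK K c) = ofK K (f₀K c)) :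
    LinearMap.range f₀ = span ℂ (ofK K (L := ℂ) '' Set.range f₀K) := by
  classical
  refine le_antisymm ?_ (span_le.mpr ?_)
  · rintro _ ⟨u, rfl⟩
    have hu : u ∈ (⊤ : Submodule ℂ (Fin a → ℂ)) := trivial
    rw [← eq_top_of_forall_ofK_mem K (T := (span ℂ (ofK K (L := ℂ) '' Set.range f₀K)).comap f₀)
      fun c => ?_] at hu
    · exact hu
    · rw [Submodule.mem_comap, hf₀]; exact subset_span ⟨f₀K c, ⟨c, rfl⟩, rfl⟩
  · rintro _ ⟨_, ⟨c, rfl⟩, rfl⟩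
    exact ⟨ofK K c, hf₀ c⟩

/-- The image of a map defined over `K` is defined over `K`. [folklore] -/
theorem isKRational_range {a b : ℕ} (f₀ : (Fin a → ℂ) →ₗ[ℂ] (Fin b → ℂ)) (f₀K : (Fin a → K) →ₗ[K] (Fin b → K))
    (hf₀ : ∀ c, f₀ (ofK K c) = ofK K (f₀K c)) : IsKRational K (LinearMap.range f₀) :=
  ⟨Set.range f₀K, range_eq_span_of_ofK f₀ f₀K hf₀⟩

/-- The image of a map defined over `ℚ`, as a `ℂ`-span. [folklore] -/
theorem range_eq_span_of_rat {a b : ℕ} (f₁ : (Fin a → ℂ) →ₗ[ℂ] (Fin b → ℂ)) (f₁₀ : (Fin a → ℚ) →ₗ[ℚ] (Fin b → ℚ))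
    (hf₁ : ∀ q : Fin a → ℚ, f₁ (fun j => ((q j : ℚ) : ℂ)) = fun i => ((f₁₀ q i : ℚ) : ℂ)) :
    LinearMap.range f₁ = span ℂ (ofK ℚ (L := ℂ) '' Set.range f₁₀) := by
  classical
  have hf₁' : ∀ q, f₁ (ofK ℚ q) = ofK ℚ (f₁₀ q) := fun q => by rw [ofK_rat_eq, ofK_rat_eq, hf₁]
  refine le_antisymm ?_ (span_le.mpr ?_)
  · rintro _ ⟨u, rfl⟩
    have hu : u ∈ (⊤ : Submodule ℂ (Fin a → ℂ)) := trivial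
    rw [← eq_top_of_forall_rat_mem (T := (span ℂ (ofK ℚ (L := ℂ) '' Set.range f₁₀)).comap f₁)
      fun q => ?_] at hu
    · exact hu
    · rw [Submodule.mem_comap, ← ofK_rat_eq, hf₁']; exact subset_span ⟨f₁₀ q, ⟨q, rfl⟩, rfl⟩
  · rintro _ ⟨_, ⟨q, rfl⟩, rfl⟩
    exact ⟨ofK ℚ q, hf₁' q⟩

/-- The image of a map defined over `ℚ` is defined over `ℚ`. [folklore] -/
theorem isKRational_range_rat {a b : ℕ} (f₁ : (Fin a → ℂ) →ₗ[ℂ] (Fin b → ℂ)) (f₁₀ : (Fin a → ℚ) →ₗ[ℚ] (Fin b → ℚ))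
    (hf₁ : ∀ q : Fin a → ℚ, f₁ (fun j => ((q j : ℚ) : ℂ)) = fun i => ((f₁₀ q i : ℚ) : ℂ)) :
    IsKRational ℚ (LinearMap.range f₁) :=
  ⟨Set.range f₁₀, range_eq_span_of_rat f₁ f₁₀ hf₁⟩

/-- Rational points of the image of an injective map defined over `ℚ` come from rational points:
if `f₁ x` is a rational vector then `x` is. [folklore] -/
theorem rat_descent {a b : ℕ} (f₁ : (Fin a → ℂ) →ₗ[ℂ] (Fin b → ℂ)) (f₁₀ : (Fin a → ℚ) →ₗ[ℚ] (Fin b → ℚ))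
    (hf₁ : ∀ q : Fin a → ℚ, f₁ (fun j => ((q j : ℚ) : ℂ)) = fun i => ((f₁₀ q i : ℚ) : ℂ))
    (hinj : Function.Injective f₁) {x : Fin a → ℂ} {q : Fin b → ℚ} (hx : f₁ x = fun i => ((q i : ℚ) : ℂ)) :
    ∃ v : Fin a → ℚ, x = fun j => ((v j : ℚ) : ℂ) := by
  classical
  have hqmem : (fun i => ((q i : ℚ) : ℂ)) ∈ LinearMap.range f₁ := ⟨x, hx⟩
  rw [range_eq_span_of_rat f₁ f₁₀ hf₁] at hqmem
  have hq' : q ∈ kPoints ℚ (span ℂ (ofK ℚ (L := ℂ) '' Set.range f₁₀)) := by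
    rw [mem_kPoints, ofK_rat_eq]; exact hqmem
  rw [kPoints_span_ofK, ← LinearMap.coe_range, Submodule.span_eq] at hq'
  obtain ⟨v, hv⟩ := hq'
  refine ⟨v, hinj ?_⟩
  rw [hx, hf₁, hv]

set_option maxHeartbeats 800000 in
/-- **Every cokernel of `𝒞` has a kernel** ("on peut montrer", p. 786): for a cokernel
`g : X → X'`, the object `X* = (e₀, k, f⁻¹W, f⁻¹Y, f⁻¹Y_a)` with `f = f₀ × f₁`, `f₀` a `K`-frame
of `ker g₀` and `f₁` an integral frame of `ker g₁`, is a kernel of `g`.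
[cite: RoyWaldschmidt1997ENS, §6 (i), (6.2)–(6.3), p. 786] -/
theorem IsCoker.exists_exact {X X' : RWObj K} {g} (hg : IsCoker X X' g) : ∃ Xs : RWObj K, Exact Xs X X' := by
  classical
  have hg' := hg
  obtain ⟨⟨hstruct, -, -, -⟩, -, -, -, -⟩ := hg'
  obtain ⟨g₀, g₁, g₀K, g₁₀, hgap, hg₀K, hg₁₀⟩ := hstruct.exists_block
  obtain ⟨e₀, f₀, f₀K, hf₀inj, hf₀range, hf₀K, hf₀desc, -⟩ := exists_kFrame K _ (isKRational_ker g₀ g₀K hg₀K)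
  obtain ⟨k, f₁, A, B, hf₁inj, hf₁range, hf₁A, hf₁B, -⟩ := exists_intFrame _ (isKRational_ker_rat g₁ g₁₀ hg₁₀)
  set f : ((Fin e₀ → ℂ) × (Fin k → ℂ)) →ₗ[ℂ] ((Fin X.d₀ → ℂ) × (Fin X.d₁ → ℂ)) := LinearMap.prodMap f₀ f₁ with hf
  have hfap : ∀ p, f p = (f₀ p.1, f₁ p.2) := fun p => rfl
  have hfinj : Function.Injective f := by
    rintro ⟨u, v⟩ ⟨u', v'⟩ h
    rw [hfap, hfap, Prod.mk.injEq] at h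
    have h1 : u = u' := hf₀inj h.1
    have h2 : v = v' := hf₁inj h.2
    rw [h1, h2]
  have hrange : LinearMap.range f = LinearMap.ker g := by
    ext ⟨u, v⟩
    rw [hf, LinearMap.range_prodMap, Submodule.mem_prod, hf₀range, hf₁range, LinearMap.mem_ker,
      LinearMap.mem_ker, LinearMap.mem_ker, hgap, Prod.mk_eq_zero]
  -- descent of first coordinates and integrality of second coordinates
  have hdesc1 : ∀ p : (Fin e₀ → ℂ) × (Fin k → ℂ), (∀ i, (f p).1 i ∈ K) → ∀ i, p.1 i ∈ K := by
    intro p hp i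
    obtain ⟨c, hc⟩ := hf₀desc p.1 (by intro i; have := hp i; rwa [hfap] at this)
    rw [hc]; simp [ofK_apply]
  have hcoord2 : ∀ (v : Fin k → ℂ) j, v j = ∑ i, (B j i : ℂ) * f₁ v i := hf₁B
  -- the kernel object
  set Ws : Submodule K ((Fin e₀ → ℂ) × (Fin k → ℂ)) := X.W.comap (f.restrictScalars K) with hWs
  set Ys : Submodule ℤ ((Fin e₀ → ℂ) × (Fin k → ℂ)) := X.Y.comap (f.restrictScalars ℤ) with hYs
  set Yas : Submodule ℤ ((Fin e₀ → ℂ) × (Fin k → ℂ)) := X.Ya.comap (f.restrictScalars ℤ) with hYas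
  have hWsK : ∀ w ∈ Ws, (∀ i, w.1 i ∈ K) ∧ (∀ j, w.2 j ∈ K) := by
    intro w hw
    have hw' : f w ∈ X.W := hw
    obtain ⟨h1, h2⟩ := X.hW _ hw'
    refine ⟨hdesc1 w h1, fun j => ?_⟩
    rw [hcoord2 w.2 j]
    exact Subalgebra.sum_mem _ fun i _ => mul_mem (intCast_mem _ _) (by have := h2 i; rwa [hfap] at this)
  haveI : Module.Finite ℤ X.Y := Module.Finite.iff_fg.mpr X.hYfg
  have hYsfg : Ys.FG := by
    let φ : Ys →ₗ[ℤ] X.Y := ((f.restrictScalars ℤ).comp Ys.subtype).codRestrict X.Y fun y => y.2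
    have hφ : Function.Injective φ := by
      intro y y' h
      have : f (y : (Fin e₀ → ℂ) × (Fin k → ℂ)) = f y' := congrArg (fun z : X.Y => (z : (Fin X.d₀ → ℂ) × (Fin X.d₁ → ℂ))) h
      exact Subtype.ext (hfinj this)
    haveI := Module.Finite.of_injective φ hφ
    exact Module.Finite.iff_fg.mp inferInstance
  have hYsK : ∀ y ∈ Ys, (∀ i, y.1 i ∈ K) ∧ (∀ j, cexp (y.2 j) ∈ K) := by
    intro y hy
    have hy' : f y ∈ X.Y := hy
    obtain ⟨h1, h2⟩ := X.hY _ hy'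
    refine ⟨hdesc1 y h1, fun j => ?_⟩
    rw [hcoord2 y.2 j]
    exact cexp_sum_int_mul_mem K _ (fun i => by have := h2 i; rwa [hfap] at this)
  have hYas_le : Yas ≤ Ys := Submodule.comap_mono X.hYa
  have hYasL : ∀ y ∈ Yas, ∀ j, IsAlgebraic ℚ (cexp (y.2 j)) := by
    intro y hy j
    have hy' : f y ∈ X.Ya := hy
    rw [hcoord2 y.2 j]
    exact isAlgebraic_cexp_sum_int_mul _ (fun i => by have := X.hYaL _ hy' i; rwa [hfap] at this)
  let Xs : RWObj K := ⟨e₀, k, Ws, hWsK, Ys, hYsfg, hYsK, Yas, hYas_le, hYasL⟩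
  have hfstruct : IsStruct K f :=
    isStruct_of_block f f₀ f₁ hfap (fun c => ⟨f₀K c, hf₀K c⟩) (exists_rat_of_int_matrix A f₁ hf₁A)
  have hker : IsKer Xs X f :=
    ⟨⟨hfstruct, Submodule.map_comap_le _ _, Submodule.map_comap_le _ _, Submodule.map_comap_le _ _⟩,
      hfinj, rfl, rfl, rfl⟩
  exact ⟨Xs, f, g, hker, hg, hrange⟩

set_option maxHeartbeats 800000 in
/-- **Every kernel of `𝒞` has a cokernel** ("on peut montrer", p. 786): for a kernel
`f : X* → X`, the object `X' = (d₀', d₁ - k, gW, gY, gY_a)` with `g = g₀ × g₁`, `g₀` the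
`K`-quotient by `im f₀` and `g₁` the integral quotient by `im f₁`, is a cokernel of `f`.
[cite: RoyWaldschmidt1997ENS, §6 (i), (6.2)–(6.3), p. 786] -/
theorem IsKer.exists_exact {Xs X : RWObj K} {f} (hf : IsKer Xs X f) : ∃ X' : RWObj K, Exact Xs X X' := by
  classical
  have hf' := hf
  obtain ⟨⟨hstruct, -, -, -⟩, -, -, -, -⟩ := hf'
  obtain ⟨f₀, f₁, f₀K, f₁₀, hfap, hf₀K, hf₁₀⟩ := hstruct.exists_block
  obtain ⟨e, g₀, g₀K, hg₀surj, hg₀ker, hg₀K, -⟩ := exists_kQuot K _ (isKRational_range f₀ f₀K hf₀K)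
  obtain ⟨k, g₁, C, hg₁surj, hg₁ker, hg₁C, -, -⟩ := exists_intQuot _ (isKRational_range_rat f₁ f₁₀ hf₁₀)
  set g : ((Fin X.d₀ → ℂ) × (Fin X.d₁ → ℂ)) →ₗ[ℂ] ((Fin e → ℂ) × (Fin (X.d₁ - k) → ℂ)) :=
    LinearMap.prodMap g₀ g₁ with hg
  have hgap : ∀ p, g p = (g₀ p.1, g₁ p.2) := fun p => rfl
  have hgsurj : Function.Surjective g := by
    rintro ⟨u, v⟩
    obtain ⟨u', rfl⟩ := hg₀surj u
    obtain ⟨v', rfl⟩ := hg₁surj v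
    exact ⟨(u', v'), rfl⟩
  have hrange : LinearMap.range f = LinearMap.ker g := by
    have hf_eq : LinearMap.range f = LinearMap.range (LinearMap.prodMap f₀ f₁) := by
      congr 1; apply LinearMap.ext; intro p; rw [hfap]; rfl
    ext ⟨u, v⟩
    rw [hf_eq, LinearMap.range_prodMap, Submodule.mem_prod, ← hg₀ker, ← hg₁ker, LinearMap.mem_ker,
      LinearMap.mem_ker, LinearMap.mem_ker, hgap, Prod.mk_eq_zero]
  -- coordinates of images
  have hco1 : ∀ u : Fin X.d₀ → ℂ, (∀ i, u i ∈ K) → ∀ i, g₀ u i ∈ K := by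
    intro u hu i
    obtain ⟨c, rfl⟩ := exists_ofK_of_mem K hu
    rw [hg₀K]; simp [ofK_apply]
  -- the cokernel object
  set W' : Submodule K ((Fin e → ℂ) × (Fin (X.d₁ - k) → ℂ)) := X.W.map (g.restrictScalars K) with hW'
  set Y' : Submodule ℤ ((Fin e → ℂ) × (Fin (X.d₁ - k) → ℂ)) := X.Y.map (g.restrictScalars ℤ) with hY'
  set Ya' : Submodule ℤ ((Fin e → ℂ) × (Fin (X.d₁ - k) → ℂ)) := X.Ya.map (g.restrictScalars ℤ) with hYa'
  have hW'K : ∀ w ∈ W', (∀ i, w.1 i ∈ K) ∧ (∀ j, w.2 j ∈ K) := by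
    rintro _ ⟨w, hw, rfl⟩
    obtain ⟨h1, h2⟩ := X.hW w hw
    refine ⟨fun i => ?_, fun l => ?_⟩
    · show (g w).1 i ∈ K
      rw [hgap]; exact hco1 w.1 h1 i
    · show (g w).2 l ∈ K
      rw [hgap]; simp only
      rw [hg₁C]
      exact Subalgebra.sum_mem _ fun j _ => mul_mem (intCast_mem _ _) (h2 j)
  have hY'fg : Y'.FG := X.hYfg.map _
  have hY'K : ∀ y ∈ Y', (∀ i, y.1 i ∈ K) ∧ (∀ j, cexp (y.2 j) ∈ K) := by
    rintro _ ⟨y, hy, rfl⟩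
    obtain ⟨h1, h2⟩ := X.hY y hy
    refine ⟨fun i => ?_, fun l => ?_⟩
    · show (g y).1 i ∈ K
      rw [hgap]; exact hco1 y.1 h1 i
    · show cexp ((g y).2 l) ∈ K
      rw [hgap]; simp only
      rw [hg₁C]
      exact cexp_sum_int_mul_mem K _ h2
  have hYa'le : Ya' ≤ Y' := Submodule.map_mono X.hYa
  have hYa'L : ∀ y ∈ Ya', ∀ j, IsAlgebraic ℚ (cexp (y.2 j)) := by
    rintro _ ⟨y, hy, rfl⟩ l
    show IsAlgebraic ℚ (cexp ((g y).2 l))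
    rw [hgap]; simp only
    rw [hg₁C]
    exact isAlgebraic_cexp_sum_int_mul _ (X.hYaL y hy)
  let X' : RWObj K := ⟨e, X.d₁ - k, W', hW'K, Y', hY'fg, hY'K, Ya', hYa'le, hYa'L⟩
  have hgstruct : IsStruct K g :=
    isStruct_of_block g g₀ g₁ hgap (fun c => ⟨g₀K c, hg₀K c⟩) (exists_rat_of_int_matrix C g₁ hg₁C)
  have hcoker : IsCoker X X' g := ⟨⟨hgstruct, le_rfl, le_rfl, le_rfl⟩, hgsurj, rfl, rfl, rfl⟩
  exact ⟨X', f, g, hf, hcoker, hrange⟩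

/-- The relational admissibility data of `𝒞` used by `RoyCategory.enonce2_of_enonce1`:
every `Quot` and every `SubO` extends to an `Exact`. [cite: RoyWaldschmidt1997ENS, §6 (i), p. 786] -/
theorem quot_exists_exact {X X' : RWObj K} (h : Quot X X') : ∃ Xs, Exact Xs X X' := by
  obtain ⟨g, hg⟩ := h; exact hg.exists_exact

/-- Every `SubO` extends to an `Exact` (every kernel has a cokernel).
[cite: RoyWaldschmidt1997ENS, §6 (i), p. 786] -/
theorem subO_exists_exact {Xs X : RWObj K} (h : SubO Xs X) : ∃ X', Exact Xs X X' := by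
  obtain ⟨f, hf⟩ := h; exact hf.exists_exact

end RoyWaldschmidt1997

end Literature.NumberTheory.Transcendental
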